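import Mathlib
import HarnessLib
import Literature.AlgebraicGeometry.Ramification.InertiaNormalSylow
import Literature.RepresentationTheory.FiniteGroups.NumberOfRationalIrreducibles
import Summits.ResolutionOfSingularities.ResolutionOfSingularities.Theorems.WildQuotientsWildQuotientResolutionOrbitSeparationPhaseZero

/-!
# Phase 0 ⟸ separation of the inert loci of CONJUGATE subgroups of PRIME order: the purely geometric residual
# (crux `WildQuotients.WildQuotientResolution`, stub `stub_phaseZeroHighDim`; any dimension)

Crux stmt-ResolutionOfSingularities-15640 (`WildQuotientResolution`), registered stub `stub_phaseZeroHighDim`.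
✓`phaseZero_of_orbitSeparation` (p822889) reduces the stub to an orbit-separating model for SOME list of tame
families covering the `p′`-elements of the non-p-closed subgroups. This file removes the group theory from the
residual: the families can always be taken to be the CONJUGACY CLASSES OF THE SUBGROUPS OF PRIME ORDER `ℓ ≠ p`
(every `h ≠ 1` of order prime to `p` contains the subgroup of order `ℓ ∣ ord h` of `⟨h⟩`). Hence:

**Theorem** (`phaseZero_of_primeOrbitSeparation`). For the crux datum, suppose there is an equivariant proper
birational regular model `X″ → X′` (faithful lifted action, `G`-stable affine cover) on which ANY TWO DISTINCT
CONJUGATE SUBGROUPS OF PRIME ORDER prime to `p` HAVE DISJOINT INERT LOCI. Then the conclusion of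
`stub_phaseZeroHighDim` holds for `X′`, in every dimension. — This geometric statement («separate the fixed loci of
conjugate prime-order tame subgroups by equivariant blow-ups of the regular `X′`») is therefore EXACTLY what remains
of Phase 0; it is the recommended RESHAPE of the stub (evidence memo PHASE0-STANDARD-FORM.md §4d/§5).

[OURS · crux stmt-ResolutionOfSingularities-15640 · helper toward `stub_phaseZeroHighDim` (final reduction of the
standard-form route; NOT a proof of the stub); counted 0; AI-level work, weaker than expert review.] [folklore]
-/

-- single-problem summit: the doubled namespace component `ResolutionOfSingularities` is forced
set_option linter.dupNamespace false

noncomputable section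

open CategoryTheory AlgebraicGeometry TopologicalSpace IsLocalRing
open Literature.AlgebraicGeometry.Resolution Literature.AlgebraicGeometry.Ramification

namespace Summit.ResolutionOfSingularities.ResolutionOfSingularities.Theorems.WildQuotientResolution.StandardForm

section Group

variable {G : Type} [Group G]

/-- The order is invariant under conjugation. [folklore] -/
theorem orderOf_conj_eq (x g : G) : orderOf (x * g * x⁻¹) = orderOf g := by
  have h := orderOf_injective (MulAut.conj x).toMonoidHom (MulAut.conj x).injective g
  simpa [MulAut.conj_apply] using h

/-- **A non-trivial element of order prime to `p` contains a subgroup of prime order prime to `p`**: with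
`ℓ ∣ ord h` prime, `⟨h ^ (ord h / ℓ)⟩ ≤ ⟨h⟩` has order `ℓ`. [folklore] -/
theorem exists_prime_zpowers_le [Finite G] {p : ℕ} {h : G} (hh1 : h ≠ 1) (hh : (orderOf h).Coprime p) :
    ∃ g : G, (orderOf g).Prime ∧ (orderOf g).Coprime p ∧ Subgroup.zpowers g ≤ Subgroup.zpowers h := by
  have hordh : orderOf h ≠ 1 := fun e => hh1 (orderOf_eq_one_iff.mp e)
  obtain ⟨ℓ, hℓp, hℓh⟩ := Nat.exists_prime_and_dvd hordh
  have h0 : orderOf h ≠ 0 := (orderOf_pos h).ne'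
  have hne : orderOf h / ℓ ≠ 0 := (Nat.div_pos (Nat.le_of_dvd (orderOf_pos h) hℓh) hℓp.pos).ne'
  have hord : orderOf (h ^ (orderOf h / ℓ)) = ℓ := by
    rw [orderOf_pow_of_dvd hne (Nat.div_dvd_of_dvd hℓh), Nat.div_div_self hℓh h0]
  refine ⟨h ^ (orderOf h / ℓ), by rw [hord]; exact hℓp, by rw [hord]; exact Nat.Coprime.coprime_dvd_left hℓh hh, ?_⟩
  exact (Subgroup.zpowers_le).mpr (Subgroup.pow_mem _ (Subgroup.mem_zpowers h) _)

end Group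

/-- **Phase 0 ⟸ separation of the inert loci of conjugate prime-order tame subgroups** (crux
stmt-ResolutionOfSingularities-15640; the geometric residual of `stub_phaseZeroHighDim`). Crux data as in the stub
(faithfulness of `ρ` is not even needed here — only that of the lifted action on the model). If some equivariant
proper birational regular model `π₀ : X″ → X′` with faithful action and a `G`-stable affine cover separates the inert
loci of any two distinct conjugate subgroups of prime order prime to `p`, then `X′` has a Phase-0 model. [folklore] -/
theorem phaseZero_of_primeOrbitSeparation (p : ℕ) (hp : p.Prime) (k : Type) [Field k] [CharP k p]
    (X' X₁ : Scheme.{0}) (f : X₁ ⟶ Spec (.of k)) (q : X' ⟶ X₁) (G : Type) [Group G] [Finite G]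
    (ρ : G →* Aut X')
    [IsSeparated f] [LocallyOfFiniteType f] [QuasiCompact f] [IsIntegral X'] [IsFinite q]
    (hρ : ∀ g : G, (ρ g).hom ≫ q = q)
    (X'' : Scheme.{0}) (π₀ : X'' ⟶ X') (ρ'' : G →* Aut X'') [IsProper π₀] (hbir₀ : IsBirational π₀)
    [IsIntegral X''] (hreg'' : Scheme.IsRegular X'') (hfaith'' : Function.Injective ρ'')
    (hequiv₀ : ∀ g : G, (ρ'' g).hom ≫ π₀ = π₀ ≫ (ρ g).hom)
    (hcov'' : ∀ y : X'', ∃ O : X''.Opens, IsAffineOpen O ∧ y ∈ O ∧ ∀ g : G, (ρ'' g).hom ⁻¹ᵁ O = O)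
    (hsep : ∀ (a : G), (orderOf a).Prime → (orderOf a).Coprime p → ∀ x : G,
      Subgroup.zpowers a ≠ Subgroup.zpowers (x * a * x⁻¹) →
      Disjoint {y : X'' | Subgroup.zpowers a ≤ inertiaSubgroup ρ'' y}
        {y : X'' | Subgroup.zpowers (x * a * x⁻¹) ≤ inertiaSubgroup ρ'' y}) :
    ∃ (Xs : Scheme.{0}) (π : Xs ⟶ X') (ρs : G →* Aut Xs), IsProper π ∧ IsBirational π ∧
      IsIntegral Xs ∧ Scheme.IsRegular Xs ∧ (∀ g : G, (ρs g).hom ≫ π = π ≫ (ρ g).hom) ∧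
      (∀ x : Xs, HasNormalSylow p (inertiaSubgroup ρs x)) ∧
      ∀ x : Xs, ∃ U : Xs.Opens, IsAffineOpen U ∧ x ∈ U ∧ ∀ g : G, (ρs g).hom ⁻¹ᵁ U = U := by
  classical
  haveI : Fintype G := Fintype.ofFinite G
  -- the families: conjugacy classes of the cyclic subgroups of prime order prime to `p`
  let fam : G → Finset (Subgroup G) := fun a =>
    (Finset.univ : Finset G).image fun x => Subgroup.zpowers (x * a * x⁻¹)
  let gens : List G := ((Finset.univ : Finset G).filter fun a => (orderOf a).Prime ∧ (orderOf a).Coprime p).toList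
  let Ss : List (Finset (Subgroup G)) := gens.map fam
  have hmem_fam : ∀ {a : G} {K : Subgroup G}, K ∈ fam a ↔ ∃ x : G, K = Subgroup.zpowers (x * a * x⁻¹) := by
    intro a K
    simp only [fam, Finset.mem_image, Finset.mem_univ, true_and]
    exact ⟨fun ⟨x, hx⟩ => ⟨x, hx.symm⟩, fun ⟨x, hx⟩ => ⟨x, hx.symm⟩⟩
  have hmem_gens : ∀ {a : G}, a ∈ gens ↔ (orderOf a).Prime ∧ (orderOf a).Coprime p := by
    intro a
    simp [gens]
  refine phaseZero_of_orbitSeparation p hp k X' X₁ f q G ρ hρ X'' π₀ ρ'' hbir₀ hreg'' hfaith'' hequiv₀ hcov'' Ss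
    (fun S hS => ?_) (fun S hS K hK K' hK' hne => ?_) (fun H _ h _ hh1 hh => ?_)
  · -- each family: conjugation-stable, without `⊥`, of order prime to `p`
    obtain ⟨a, ha, rfl⟩ := List.mem_map.mp hS
    obtain ⟨hapr, hacop⟩ := hmem_gens.mp ha
    refine ⟨fun g K hK => ?_, fun h1 => ?_, fun K hK => ?_⟩
    · obtain ⟨x, rfl⟩ := hmem_fam.mp hK
      refine hmem_fam.mpr ⟨g * x, ?_⟩
      rw [Literature.RepresentationTheory.FiniteGroups.zpowers_map_mulAut_conj]
      congr 1
      group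
    · obtain ⟨x, hx⟩ := hmem_fam.mp h1
      have h2 : x * a * x⁻¹ = 1 := Subgroup.zpowers_eq_bot.mp hx.symm
      have h3 : orderOf (x * a * x⁻¹) = 1 := by rw [h2, orderOf_one]
      rw [orderOf_conj_eq] at h3
      exact hapr.one_lt.ne' h3
    · obtain ⟨x, rfl⟩ := hmem_fam.mp hK
      rw [Nat.card_zpowers, orderOf_conj_eq]
      exact hacop
  · -- disjointness inside a family, from the geometric hypothesis
    obtain ⟨a, ha, rfl⟩ := List.mem_map.mp hS
    obtain ⟨hapr, hacop⟩ := hmem_gens.mp ha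
    obtain ⟨x, rfl⟩ := hmem_fam.mp hK
    obtain ⟨x', rfl⟩ := hmem_fam.mp hK'
    have e : x' * a * x'⁻¹ = (x' * x⁻¹) * (x * a * x⁻¹) * (x' * x⁻¹)⁻¹ := by group
    rw [e] at hne ⊢
    exact hsep (x * a * x⁻¹) ((orderOf_conj_eq x a).symm ▸ hapr) ((orderOf_conj_eq x a).symm ▸ hacop)
      (x' * x⁻¹) hne
  · -- a tame `h ≠ 1` contains a member of some family
    obtain ⟨g, hgpr, hgcop, hle⟩ := exists_prime_zpowers_le hh1 hh
    refine ⟨fam g, List.mem_map.mpr ⟨g, hmem_gens.mpr ⟨hgpr, hgcop⟩, rfl⟩, Subgroup.zpowers g,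
      hmem_fam.mpr ⟨1, by simp⟩, hle⟩

end Summit.ResolutionOfSingularities.ResolutionOfSingularities.Theorems.WildQuotientResolution.StandardForm

end
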